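import Summits.ResolutionOfSingularities.ResolutionOfSingularities.Theorems.FrobeniusClosingPatchingRelPerfectConeDepthTwoCharts
import HarnessLib

/-!
# Crux `PatchingRelPerfect` (stmt-ResolutionOfSingularities-16161), chain w52 — the next honest
# test after the cone: the RANK-TWO member `f = x₀x₁ + x₂³`, `I = (f) + 𝔪⁴` — level-one chart ideals

[OURS · L1 W5.2 · rung, DESIGN STAGE] This seat's design note NEXT-two-planes-cube.md (evidence on the
crux item; chart images machine-checked over `ℚ`, kit j282646): the initial form `x₀x₁` is a pair of
planes in `E ≅ ℙ³` meeting along the line `L = V(T₀, T₁)`; maximal contact migrates to the strict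
transform `H` of `V(f)` along `L`, and `H` is singular at the point `z₀ = [0:0:0:1]` along a curve
transversal to `E` (`V(f) ≅ A₂ × line`).  Candidate companion factors and their total transforms
on the Rees charts `B_i = S[x/x_i]` (`u = x_i`, `e_j = x_j/x_i`, `H♯ = e₀e₁ + u e₂³` — ANY commutative
ring `S`), PROVED here:

* `chartBase_fT` — `φ(f) = u² H♯`;
* `map_chartBase_tpA`   — `A  = (f) + x₀𝔪 + 𝔪³  ↦ u² · (e₀, u)`   (the PLANE centre `Π₀ = V(u, e₀)`;
  the unit ideal on `B₀` where `e₀ = 1`);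
* `map_chartBase_tpA3`  — `A₃ = (f) + 𝔪³       ↦ u² · (e₀e₁, u)`;
* `map_chartBase_tpA4`  — `A₄ = (f) + x₀𝔪² + 𝔪⁴ ↦ u² · ((H♯) + (u e₀) + (u²))`;
* `map_chartBase_tpI`   — `I  = (f) + 𝔪⁴       ↦ u² · ((H♯) + (u²))`.
(The avatar `J_q = (x₀) + (x₁,x₂)(x₁,x₂,x₃) + (x₃³)` of the point `q` over `z₀` — design note
Addendum 4 — is left to the sequel.)

After `Bl_{Π₀}` the factors `A₃, A₄, I` become the letter flag `(c, t)(c, t e₀)(c, t e₀ t)` on the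
`t`-charts (kit-checked) — to be proved in the sequel.  Nothing here is a statement of the manuscript
under review.

## References

* The Stacks Project, Tag 0804 (affine blow-up algebras and their charts). [StacksProject]
-/

-- `Summit.<Summit>.<Sub>.Theorems` with `Sub = Summit` (single-conjunct summit, D-0017)
set_option linter.dupNamespace false

noncomputable section

open CategoryTheory CategoryTheory.Limits AlgebraicGeometry Literature.AlgebraicGeometry.Resolution
open IsLocalRing

namespace Summit.ResolutionOfSingularities.ResolutionOfSingularities.Theorems

namespace TwoPlanesRung

universe u

section LevelOne

variable {S : Type u} [CommRing S] (x : Fin 4 → S) (i : Fin 4)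

local notation3 "M" => Ideal.span (Set.range x)
local notation3 "fT" => x 0 * x 1 + x 2 ^ 3
local notation3 "φ" => chartBase x i
local notation3 "u" => chartBase x i (x i)
local notation3 "e[" j "]" => chartGen x i j
local notation3 "Hs" => chartGen x i 0 * chartGen x i 1 + chartBase x i (x i) * chartGen x i 2 ^ 3
local notation3 "U" => Ideal.span {chartBase x i (x i)}

/-- **`φ(f) = u² · H♯`**, `H♯ = e₀e₁ + u e₂³`, on every chart. [folklore] -/
theorem chartBase_fT : φ fT = u ^ 2 * Hs := by
  rw [map_add, map_mul, map_pow, reesChartBase_apply_eq_mul_chartGen x i 0,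
    reesChartBase_apply_eq_mul_chartGen x i 1, reesChartBase_apply_eq_mul_chartGen x i 2]
  ring

/-- `(f) B_i = u² (H♯)`. [folklore] -/
theorem map_chartBase_span_fT : (Ideal.span {fT}).map φ = U ^ 2 * Ideal.span {Hs} := by
  rw [Ideal.map_span, Set.image_singleton, chartBase_fT, ConeRung.span_pow_mul]

/-- `(x₀) B_i = (u e₀)`. [folklore] -/
theorem map_chartBase_span_x0 : (Ideal.span {x 0}).map φ = U * Ideal.span {e[0]} := by
  rw [Ideal.map_span, Set.image_singleton, reesChartBase_apply_eq_mul_chartGen x i 0,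
    Ideal.span_singleton_mul_span_singleton]

/-- **`A = (f) + x₀𝔪 + 𝔪³ ↦ u² · (e₀, u)`** — the plane centre `Π₀ = V(u, e₀)` (`H♯ ∈ (e₀, u)`).
[folklore] -/
theorem map_chartBase_tpA :
    (Ideal.span {fT} ⊔ Ideal.span {x 0} * M ⊔ M ^ 3).map φ = U ^ 2 * Ideal.span {e[0], u} := by
  rw [Ideal.map_sup, Ideal.map_sup, Ideal.map_mul, Ideal.map_pow, ConeRung.map_chartBase_M,
    map_chartBase_span_fT, map_chartBase_span_x0]
  have e3 : U ^ 3 = U ^ 2 * U := pow_succ _ 2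
  have e2 : U * Ideal.span {e[0]} * U = U ^ 2 * Ideal.span {e[0]} := by ring
  rw [e2, e3, ← Ideal.mul_sup, ← Ideal.mul_sup]
  congr 1
  -- `(H♯) + (e₀) + (u) = (e₀, u)` since `H♯ = e₁ · e₀ + e₂³ · u`
  rw [Ideal.span_insert]
  refine le_antisymm (sup_le (sup_le ?_ le_sup_left) le_sup_right)
    (sup_le (le_sup_of_le_left le_sup_right) le_sup_right)
  rw [Ideal.span_singleton_le_iff_mem]
  exact Ideal.add_mem _ (Ideal.mem_sup_left (Ideal.mul_mem_right _ _ (Ideal.subset_span rfl)))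
    (Ideal.mem_sup_right (Ideal.mul_mem_right _ _ (Ideal.subset_span rfl)))

/-- **`A₃ = (f) + 𝔪³ ↦ u² · (e₀e₁, u)`** (`H♯ ≡ e₀e₁ mod u`). [folklore] -/
theorem map_chartBase_tpA3 :
    (Ideal.span {fT} ⊔ M ^ 3).map φ = U ^ 2 * Ideal.span {e[0] * e[1], u} := by
  rw [Ideal.map_sup, Ideal.map_pow, ConeRung.map_chartBase_M, map_chartBase_span_fT,
    pow_succ (Ideal.span {chartBase x i (x i)}) 2, ← Ideal.mul_sup, Ideal.span_insert]
  congr 1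
  apply le_antisymm
  · refine sup_le ?_ le_sup_right
    rw [Ideal.span_singleton_le_iff_mem]
    exact Ideal.add_mem _ (Ideal.mem_sup_left (Ideal.subset_span rfl))
      (Ideal.mem_sup_right (Ideal.mul_mem_right _ _ (Ideal.subset_span rfl)))
  · refine sup_le ?_ le_sup_right
    rw [Ideal.span_singleton_le_iff_mem, Ideal.mem_span_singleton_sup]
    exact ⟨1, -(e[2] ^ 3 * u), neg_mem (Ideal.mul_mem_left _ _ (Ideal.subset_span rfl)),
      by ring⟩

/-- **`A₄ = (f) + x₀𝔪² + 𝔪⁴ ↦ u² · ((H♯) + (u e₀) + (u²))`**. [folklore] -/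
theorem map_chartBase_tpA4 :
    (Ideal.span {fT} ⊔ Ideal.span {x 0} * M ^ 2 ⊔ M ^ 4).map φ =
      U ^ 2 * (Ideal.span {Hs} ⊔ U * Ideal.span {e[0]} ⊔ U ^ 2) := by
  rw [Ideal.map_sup, Ideal.map_sup, Ideal.map_mul, Ideal.map_pow, Ideal.map_pow,
    ConeRung.map_chartBase_M, map_chartBase_span_fT, map_chartBase_span_x0, Ideal.mul_sup,
    Ideal.mul_sup]
  congr 2
  · ring
  · rw [← pow_add]

/-- **`I = (f) + 𝔪⁴ ↦ u² · ((H♯) + (u²))`**. [folklore] -/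
theorem map_chartBase_tpI :
    (Ideal.span {fT} ⊔ M ^ 4).map φ = U ^ 2 * (Ideal.span {Hs} ⊔ U ^ 2) := by
  rw [Ideal.map_sup, Ideal.map_pow, ConeRung.map_chartBase_M, map_chartBase_span_fT, Ideal.mul_sup,
    ← pow_add]

end LevelOne

end TwoPlanesRung

end Summit.ResolutionOfSingularities.ResolutionOfSingularities.Theorems

end
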